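import Summits.CriticalPhenomena.PercolationContinuityZ3.Theorems.Transplant.Slab111HubXPlan
import HarnessLib

/-!
# The HUB ROUTING of the `(111)`-films, XIV-X: the `HubDataX` and the swap pair of a zone-free hub plan `HubPlanX`

builds on p205010 (kernel theorem, internal audit signed; external expert review pending) — NOT used in this file.  Lane `prim-bschramm`, seat
`prim-bschramm-p2` (gen 37; class C1b; memo `HOME/bschramm/P2-LATTICES.md` §135); helper file (`--supports stmt-CriticalPhenomena-4575 --as helper`).
«Slab111HubBuild2» for «Slab111HubXPlan».`HubPlanX` (exact ride windows; hub levels in `[1, k−1]`; the window endpoints are the leg ends and the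
attachment vertices, all other window levels are bulk levels): **`HubPlanX.toHubDataX`** and the swap pair **`HubPlanX.swap`** via «Slab111HubXRoute2».`HubDataX.hub_gml`.
[cite: DuminilCopinSidoraviciusTassion2016, §2.3 (proof of Fact 2: the three disjoint paths γ_u, γ_v, γ_w in B_R(z))]
-/

noncomputable section

namespace Summit.CriticalPhenomena.PercolationContinuityZ3.Theorems.Transplant

open Literature.Probability.Percolation Literature.Probability.LatticeModels SimpleGraph
open scoped Classical

namespace Slab111

namespace HubPlanX

variable {k : ℕ} {h : Site 2} {c0 : ℤ} {W PR : Set (slab111 k)} {E₁ E₂ w' : slab111 k} (Q : HubPlanX k h c0 W PR E₁ E₂ w')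

/-- A level of a window `[min a b, max a b]` outside the bulk `[1, k−1]` is an endpoint, when both endpoints lie in `[0, k]`. [folklore] -/
theorem toHubData_aux (L a b : ℤ) (hlo : min a b ≤ L) (hhi : L ≤ max a b) (hL : ¬(1 ≤ L ∧ L ≤ (k : ℤ) - 1))
    (ha : 0 ≤ a ∧ a ≤ k) (hb : 0 ≤ b ∧ b ≤ k) : L = a ∨ L = b := by
  rcases le_total a b with h | h
  · rw [min_eq_left h, max_eq_right h] at *; omega
  · rw [min_eq_right h, max_eq_left h] at *; omega

/-- A level of a window `[min a (min b c), max a (max b c)]` outside the bulk is one of `a, b, c`, when all three lie in `[0, k]`. [folklore] -/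
theorem toHubData_aux3 (L a b c : ℤ) (hlo : min a (min b c) ≤ L) (hhi : L ≤ max a (max b c)) (hL : ¬(1 ≤ L ∧ L ≤ (k : ℤ) - 1))
    (ha : 0 ≤ a ∧ a ≤ k) (hb : 0 ≤ b ∧ b ≤ k) (hc : 0 ≤ c ∧ c ≤ k) : L = a ∨ L = b ∨ L = c := by
  simp only [min_le_iff, le_max_iff] at hlo hhi
  omega

/-- **The `HubDataX` of a zone-free hub plan.** [cite: DuminilCopinSidoraviciusTassion2016, §2.3 (proof of Fact 2: γ_u, γ_v, γ_w)] -/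
def toHubDataX : HubDataX k h c0 W PR E₁ E₂ w' where
  F1 := Q.F1
  F2 := Q.F2
  F3 := Q.F3
  d₁ := Q.d₁
  d₂ := Q.d₂
  d₃ := Q.d₃
  LA := Q.LA
  LD := Q.LD
  τ := Q.τ
  ℓ₁ := Q.ℓ₁
  ℓ₂ := Q.ℓ₂
  ℓ₃ := Q.ℓ₃
  m₁ := (Q.τ * (Q.LA + Q.d₁ - Q.ℓ₁)).toNat
  leg₁ := legV k h Q.q₁ Q.n₁ Q.l₁
  leg₂ := (legV k h Q.q₂ Q.n₂ Q.l₂).reverse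
  leg₃ := (legV k h Q.q₃ Q.n₃ Q.l₃).reverse
  hz := Q.hz
  hPRW := Q.hPRW
  hF1 := Q.hF1
  hF2 := Q.hF2
  hF3 := Q.hF3
  ho1 := Q.ho1
  ho2 := Q.ho2
  ho3 := Q.ho3
  h12 := Q.h12
  h13 := Q.h13
  h23 := Q.h23
  hA1 := Q.hA1
  hA2 := Q.hA2
  hA3 := Q.hA3
  hτ := Q.hτ
  hLD := Q.hLD
  hLA := Q.hLA
  hLA1 := Q.hLA1
  hLAk := by have := Q.hLAk; omega
  hLD1 := Q.hLD1
  hLDk := by have := Q.hLDk; omega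
  hne := Q.hne
  hℓ₁ := by have := Q.rng.1 _ (List.getLast_mem Q.hl1.1); exact this
  hℓ₂ := by have := Q.rng.2.1 _ (List.getLast_mem Q.hl2.1); exact this
  hℓ₃ := by have := Q.rng.2.2 _ (List.getLast_mem Q.hl3.1); exact this
  hm₁ := by
    have hs := Q.hside
    rw [Int.toNat_of_nonneg (by unfold ℓ₁; exact hs)]
    rcases Q.hτ with e | e <;> rw [e] <;> ring
  hW1 := by
    intro L hlo hhi
    by_cases hL : 1 ≤ L ∧ L ≤ (k : ℤ) - 1
    · exact HubPlan.ride_mem Q.hF1 Q.hF1P Q.hPc hL.1 hL.2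
    · -- then `L` is an endpoint of the window: `ℓ₁` (the leg end) or `LD + d₁` (the attachment vertex)
      have hr := Q.rng.1 _ (List.getLast_mem Q.hl1.1)
      have h2 := Q.hLA1; have h3 := Q.hLAk; have h4 := Q.hLD1; have h5 := Q.hLDk
      rcases toHubData_aux (k := k) L Q.ℓ₁ (Q.LD + Q.d₁) hlo hhi hL (by unfold ℓ₁; exact hr)
        (by rcases Q.hA1.dir_eq with e | e <;> rw [e] <;> constructor <;> omega) with rfl | rfl
      · rw [← Q.last_eq.1]; exact Q.last_mem1
      · exact Q.hatD1
  hW2 := by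
    intro L hlo hhi
    by_cases hL : 1 ≤ L ∧ L ≤ (k : ℤ) - 1
    · exact HubPlan.ride_mem Q.hF2 Q.hF2P Q.hPc hL.1 hL.2
    · have hr := Q.rng.2.1 _ (List.getLast_mem Q.hl2.1)
      have h2 := Q.hLA1; have h3 := Q.hLAk; have h4 := Q.hLD1; have h5 := Q.hLDk
      rw [← min_add_add_right] at hlo; rw [← max_add_add_right] at hhi
      rcases toHubData_aux3 (k := k) L Q.ℓ₂ (Q.LA + Q.d₂) (Q.LD + Q.d₂) hlo hhi hL (by unfold ℓ₂; exact hr)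
        (by rcases Q.hA2.dir_eq with e | e <;> rw [e] <;> constructor <;> omega)
        (by rcases Q.hA2.dir_eq with e | e <;> rw [e] <;> constructor <;> omega) with rfl | rfl | rfl
      · rw [← Q.last_eq.2.1]; exact Q.last_mem2
      · exact Q.hatA2
      · exact Q.hatD2
  hW3 := by
    intro L hlo hhi
    by_cases hL : 1 ≤ L ∧ L ≤ (k : ℤ) - 1
    · exact HubPlan.ride_mem Q.hF3 Q.hF3W Q.hWc hL.1 hL.2
    · have hr := Q.rng.2.2 _ (List.getLast_mem Q.hl3.1)
      have h2 := Q.hLA1; have h3 := Q.hLAk; have h4 := Q.hLD1; have h5 := Q.hLDk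
      rw [← min_add_add_right] at hlo; rw [← max_add_add_right] at hhi
      rcases toHubData_aux3 (k := k) L Q.ℓ₃ (Q.LA + Q.d₃) (Q.LD + Q.d₃) hlo hhi hL (by unfold ℓ₃; exact hr)
        (by rcases Q.hA3.dir_eq with e | e <;> rw [e] <;> constructor <;> omega)
        (by rcases Q.hA3.dir_eq with e | e <;> rw [e] <;> constructor <;> omega) with rfl | rfl | rfl
      · rw [← Q.last_eq.2.2]; exact Q.last_mem3
      · exact Q.hatA3
      · exact Q.hatD3
  hHA := by
    have := Q.hPc (0, 0) ?_ Q.LA (by have := Q.hLA1; omega) (by have := Q.hLAk; omega) (by simpa using Q.hLA)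
    · have e : vcol h ((0 : ℤ), (0 : ℤ)) = h := by ext i; fin_cases i <;> simp [vcol]
      rw [e] at this; exact this
    · exact Q.hub_mem
  hHD := by
    have := Q.hPc (0, 0) Q.hub_mem Q.LD (by have := Q.hLD1; omega) (by have := Q.hLDk; omega) (by
      have : Q.LD - c0 - ((0 : ℤ) + 2 * 0) = (Q.LA - c0) + 3 * Q.τ := by rw [Q.hLD]; ring
      rw [this]; exact dvd_add Q.hLA (dvd_mul_right 3 _))
    have e : vcol h ((0 : ℤ), (0 : ℤ)) = h := by ext i; fin_cases i <;> simp [vcol]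
    rw [e] at this; exact this
  hl1 := by
    have g := leg_gpath (k := k) Q.hz Q.hq.1 Q.hl1 Q.rng.1
    rw [← Q.E_eq.1, Q.last_eq.1] at g; exact g
  hl2 := by
    have g := (leg_gpath (k := k) Q.hz Q.hq.2.1 Q.hl2 Q.rng.2.1).reverse
    rw [← Q.E_eq.2.1, Q.last_eq.2.1] at g; exact g
  hl3 := by
    have g := (leg_gpath (k := k) Q.hz Q.hq.2.2 Q.hl3 Q.rng.2.2).reverse
    rw [← Q.E_eq.2.2, Q.last_eq.2.2] at g; exact g
  hL1 := by
    intro v hv hve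
    obtain ⟨p, hp, rfl⟩ := mem_legV.1 hv
    have hpl : p ≠ Q.l₁.getLast Q.hl1.1 := fun e => hve (by rw [e, Q.last_eq.1])
    obtain ⟨hs, hl⟩ := sh_lev_legV (k := k) Q.hz Q.hq.1 (Q.hl1.2.2.2.2 p hp) (Q.rng.1 p hp).1 (Q.rng.1 p hp).2
    refine ⟨Or.inl (offCols_of_not_mem (Q.ho1' p hp hpl) hs), ?_, ?_, ?_, ?_⟩
    · rcases Q.s21 p hp hpl with hc | hlt | hgt
      · exact Or.inl (offCols_of_not_mem hc hs)
      · exact Or.inr (Or.inl (by rw [hl]; exact hlt))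
      · exact Or.inr (Or.inr (by rw [hl]; exact hgt))
    · rcases Q.s31 p hp hpl with hc | hlt | hgt
      · exact Or.inl (offCols_of_not_mem hc hs)
      · exact Or.inr (Or.inl (by rw [hl]; exact hlt))
      · exact Or.inr (Or.inr (by rw [hl]; exact hgt))
    · rcases Q.hh1 p hp hpl with hc | hlv
      · left; rw [hs]; intro e; exact hc (vcol_injective h e)
      · right; rw [hl]; exact hlv
    · intro hvE
      have hp0 : p ≠ ((0, 0), 0) := by
        rintro rfl; apply hvE
        rw [absV_zero]; exact Q.E_eq.1.symm
      exact (Q.hc1 p hp hp0).2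
  hL2 := by
    intro v hv hve
    rw [List.mem_reverse] at hv
    obtain ⟨p, hp, rfl⟩ := mem_legV.1 hv
    have hpl : p ≠ Q.l₂.getLast Q.hl2.1 := fun e => hve (by rw [e, Q.last_eq.2.1])
    obtain ⟨hs, hl⟩ := sh_lev_legV (k := k) Q.hz Q.hq.2.1 (Q.hl2.2.2.2.2 p hp) (Q.rng.2.1 p hp).1 (Q.rng.2.1 p hp).2
    refine ⟨?_, Or.inl (offCols_of_not_mem (Q.ho2' p hp hpl) hs), ?_, ?_, ?_⟩
    · rcases Q.s12 p hp hpl with hc | hlt | hgt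
      · exact Or.inl (offCols_of_not_mem hc hs)
      · exact Or.inr (Or.inl (by rw [hl]; exact hlt))
      · exact Or.inr (Or.inr (by rw [hl]; exact hgt))
    · rcases Q.s32 p hp hpl with hc | hlt | hgt
      · exact Or.inl (offCols_of_not_mem hc hs)
      · exact Or.inr (Or.inl (by rw [hl]; exact hlt))
      · exact Or.inr (Or.inr (by rw [hl]; exact hgt))
    · rcases Q.hh2 p hp hpl with hc | hlv
      · left; rw [hs]; intro e; exact hc (vcol_injective h e)
      · right; rw [hl]; exact hlv
    · intro hvE
      have hp0 : p ≠ ((0, 0), 0) := by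
        rintro rfl; apply hvE
        rw [absV_zero]; exact Q.E_eq.2.1.symm
      exact (Q.hc2 p hp hp0).2
  hL3 := by
    intro v hv hve
    rw [List.mem_reverse] at hv
    obtain ⟨p, hp, rfl⟩ := mem_legV.1 hv
    have hpl : p ≠ Q.l₃.getLast Q.hl3.1 := fun e => hve (by rw [e, Q.last_eq.2.2])
    obtain ⟨hs, hl⟩ := sh_lev_legV (k := k) Q.hz Q.hq.2.2 (Q.hl3.2.2.2.2 p hp) (Q.rng.2.2 p hp).1 (Q.rng.2.2 p hp).2
    refine ⟨?_, ?_, Or.inl (offCols_of_not_mem (Q.ho3' p hp hpl) hs), ?_, ?_⟩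
    · rcases Q.s13 p hp hpl with hc | hlt | hgt
      · exact Or.inl (offCols_of_not_mem hc hs)
      · exact Or.inr (Or.inl (by rw [hl]; exact hlt))
      · exact Or.inr (Or.inr (by rw [hl]; exact hgt))
    · rcases Q.s23 p hp hpl with hc | hlt | hgt
      · exact Or.inl (offCols_of_not_mem hc hs)
      · exact Or.inr (Or.inl (by rw [hl]; exact hlt))
      · exact Or.inr (Or.inr (by rw [hl]; exact hgt))
    · rcases Q.hh3 p hp hpl with hc | hlv
      · left; rw [hs]; intro e; exact hc (vcol_injective h e)
      · right; rw [hl]; exact hlv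
    · by_cases hp0 : p = ((0, 0), 0)
      · subst hp0
        rw [absV_zero, ← Q.E_eq.2.2]; exact Q.hE3W
      · exact (Q.hc3 p hp hp0).2
  hL12 := by
    intro v hv hve u hu hue heq
    obtain ⟨p, hp, rfl⟩ := mem_legV.1 hv
    rw [List.mem_reverse] at hu
    obtain ⟨p', hp', rfl⟩ := mem_legV.1 hu
    have hpl : p ≠ Q.l₁.getLast Q.hl1.1 := fun e => hve (by rw [e, Q.last_eq.1])
    have hpl' : p' ≠ Q.l₂.getLast Q.hl2.1 := fun e => hue (by rw [e, Q.last_eq.2.1])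
    obtain ⟨hs, hl⟩ := sh_lev_legV (k := k) Q.hz Q.hq.1 (Q.hl1.2.2.2.2 p hp) (Q.rng.1 p hp).1 (Q.rng.1 p hp).2
    obtain ⟨hs', hl'⟩ := sh_lev_legV (k := k) Q.hz Q.hq.2.1 (Q.hl2.2.2.2.2 p' hp') (Q.rng.2.1 p' hp').1 (Q.rng.2.1 p' hp').2
    apply Q.d12 p hp hpl p' hp' hpl'
    have h1 := congrArg sh heq; rw [hs, hs'] at h1
    have h2 := congrArg (fun x : slab111 k => lev (x : Site 3)) heq; simp only [hl, hl'] at h2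
    exact Prod.ext (vcol_injective h h1) h2
  hL13 := by
    intro v hv hve u hu hue heq
    obtain ⟨p, hp, rfl⟩ := mem_legV.1 hv
    rw [List.mem_reverse] at hu
    obtain ⟨p', hp', rfl⟩ := mem_legV.1 hu
    have hpl : p ≠ Q.l₁.getLast Q.hl1.1 := fun e => hve (by rw [e, Q.last_eq.1])
    have hpl' : p' ≠ Q.l₃.getLast Q.hl3.1 := fun e => hue (by rw [e, Q.last_eq.2.2])
    obtain ⟨hs, hl⟩ := sh_lev_legV (k := k) Q.hz Q.hq.1 (Q.hl1.2.2.2.2 p hp) (Q.rng.1 p hp).1 (Q.rng.1 p hp).2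
    obtain ⟨hs', hl'⟩ := sh_lev_legV (k := k) Q.hz Q.hq.2.2 (Q.hl3.2.2.2.2 p' hp') (Q.rng.2.2 p' hp').1 (Q.rng.2.2 p' hp').2
    apply Q.d13 p hp hpl p' hp' hpl'
    have h1 := congrArg sh heq; rw [hs, hs'] at h1
    have h2 := congrArg (fun x : slab111 k => lev (x : Site 3)) heq; simp only [hl, hl'] at h2
    exact Prod.ext (vcol_injective h h1) h2
  hL23 := by
    intro v hv hve u hu hue heq
    rw [List.mem_reverse] at hv
    obtain ⟨p, hp, rfl⟩ := mem_legV.1 hv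
    rw [List.mem_reverse] at hu
    obtain ⟨p', hp', rfl⟩ := mem_legV.1 hu
    have hpl : p ≠ Q.l₂.getLast Q.hl2.1 := fun e => hve (by rw [e, Q.last_eq.2.1])
    have hpl' : p' ≠ Q.l₃.getLast Q.hl3.1 := fun e => hue (by rw [e, Q.last_eq.2.2])
    obtain ⟨hs, hl⟩ := sh_lev_legV (k := k) Q.hz Q.hq.2.1 (Q.hl2.2.2.2.2 p hp) (Q.rng.2.1 p hp).1 (Q.rng.2.1 p hp).2
    obtain ⟨hs', hl'⟩ := sh_lev_legV (k := k) Q.hz Q.hq.2.2 (Q.hl3.2.2.2.2 p' hp') (Q.rng.2.2 p' hp').1 (Q.rng.2.2 p' hp').2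
    apply Q.d23 p hp hpl p' hp' hpl'
    have h1 := congrArg sh heq; rw [hs, hs'] at h1
    have h2 := congrArg (fun x : slab111 k => lev (x : Site 3)) heq; simp only [hl, hl'] at h2
    exact Prod.ext (vcol_injective h h1) h2

/-- **THE SWAP PAIR OF A ZONE-FREE HUB PLAN.** [cite: DuminilCopinSidoraviciusTassion2016, §2.3 (proof of Fact 2: the three disjoint paths γ_u, γ_v, γ_w in B_R(z))] -/
theorem swap (Q : HubPlanX k h c0 W PR E₁ E₂ w') : ∃ r₁ r₂ : VRouteData (film k) PR W E₁ E₂ w', r₁.y = r₂.b ∧ r₁.b = r₂.y :=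
  Q.toHubDataX.hub_gml

end HubPlanX

end Slab111

end Summit.CriticalPhenomena.PercolationContinuityZ3.Theorems.Transplant

end
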